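import Summits.QuantumFields.GaugeBoot.SymmetricBootstrapConvergenceZd
import HarnessLib

/-!
# Convergence of a truncated bootstrap with imposed invariances AND imposed cuts (gauge-boot, L1/L4 supplement)

HONEST FRAMING (cell `pub-gaugeboot`, page 1 of every file): the venture produces certified bounds
on lattice expectations at stated coupling, gauge group, dimension and torus size; NOT a mass gap,
NOT a continuum limit, NOT a string tension; NOT Yang–Mills-summit-bearing (barriers
`FixedCouplingUltralocality`, `PerturbativeInvisibility`). Structural; it certifies no number.

## Content (any lattice, any compact group, exponential one-link shifts, polynomial local actions)

`bootstrap_convergence_invariant` (`SymmetricBootstrapConvergenceZd`) lets a truncated bootstrap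
carry a family of imposed INVARIANCES `φ (a ∘ R) = φ a` to its untruncated cluster points. A
practical lattice bootstrap also imposes CUTS — linear inequalities `0 ≤ φ b` on prescribed
observables `b` (reflection-positivity cuts, `BootstrapRPCutsZd`; large-`N` or convexity cuts
elsewhere). Each cut is a closed condition, so the same Tychonoff cluster-point argument carries
every cut which is imposed from some level on:

* ★★ `bootstrap_convergence_constrained` — invariances `𝓡` (polynomial-preserving maps) and cuts:
  at level `n` the SDP imposes `0 ≤ φ b` for `b ∈ 𝓑 n`; every `b` of the limit family `𝓑∞` is a
  polynomial observable imposed at all large levels. Then for every polynomial `P` and `ε > 0` there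
  is a level `n` such that every level-`n` feasible, `𝓡`-invariant (on `V n`) functional satisfying
  the level-`n` cuts gives `P` a value within `ε` of `ψ P` for an UNTRUNCATED solution `ψ` which is
  `𝓡`-invariant on all polynomials and satisfies ALL the cuts of `𝓑∞`.

What this is NOT: which measures realise such `ψ` (that is the job of the sequel using it, e.g.
`RPBootstrapConvergenceZd`: RP cuts ⟹ reflection-positive Gibbs states); rates.

References: folklore (compactness); cf. J. B. Lasserre, Moments, Positive Polynomials and Their
Applications (2010) Ch. 4 (convergence of constrained moment hierarchies).
-/

noncomputable section

open MeasureTheory Filter Topology NormedSpace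
open Literature.MathematicalPhysics.QuantumFieldTheory (LatticeRep)
open Literature.MathematicalPhysics.QuantumLattice

namespace Summit.QuantumFields.GaugeBoot

section General

variable {ι : Type*} [DecidableEq ι] {G : Type*} [Group G] [TopologicalSpace G]
  [IsTopologicalGroup G] (r : LatticeRep G) {K : Type*}
  {k : K → ℝ → G} {X : K → Matrix (Fin r.N) (Fin r.N) ℂ} {S : ι → (ι → G) → ℝ} {β : ℝ}

/-- ★★ **Convergence of a truncated bootstrap with imposed invariances and imposed cuts.**
Exponential one-link shifts, polynomial local actions, any truncation scheme `V n` eventually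
containing each polynomial observable, a family `𝓡` of polynomial-preserving configuration maps, and
cut families `𝓑 n` with a limit family `𝓑∞` of polynomial observables each imposed at all large
levels. For every polynomial `P` and `ε > 0` there is a level `n` such that every level-`n` feasible
functional, `𝓡`-invariant on `V n` and non-negative on `𝓑 n`, gives `P` a value within `ε` of
`ψ P` for some solution `ψ` of the UNTRUNCATED bootstrap, `𝓡`-invariant on all polynomials and
non-negative on all of `𝓑∞`. [folklore] -/
theorem bootstrap_convergence_constrained (hk : ∀ a s t, k a (s + t) = k a s * k a t)
    (hX : ∀ a t, r.ρ (k a t) = exp ((t : ℂ) • X a)) (hS : ∀ i, S i ∈ polyFunctions (ι := ι) r)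
    (V : ℕ → Set C(ι → G, ℝ)) (hex : ∀ a ∈ polyAlgebra (ι := ι) r, ∀ᶠ n in atTop, a ∈ V n)
    (𝓡 : Set C(ι → G, ι → G))
    (h𝓡 : ∀ R ∈ 𝓡, ∀ a ∈ polyAlgebra (ι := ι) r, a.comp R ∈ polyAlgebra (ι := ι) r)
    (𝓑 : ℕ → Set C(ι → G, ℝ)) (𝓑inf : Set C(ι → G, ℝ))
    (h𝓑poly : ∀ b ∈ 𝓑inf, b ∈ polyAlgebra (ι := ι) r) (h𝓑ev : ∀ b ∈ 𝓑inf, ∀ᶠ n in atTop, b ∈ 𝓑 n)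
    {P : C(ι → G, ℝ)} (hP : P ∈ polyAlgebra (ι := ι) r) {ε : ℝ} (hε : 0 < ε) :
    ∃ n, ∀ φ : C(ι → G, ℝ) →ₗ[ℝ] ℝ, IsBootstrapFeasible r k S β (V n) φ →
      (∀ R ∈ 𝓡, ∀ a ∈ V n, φ (a.comp R) = φ a) → (∀ b ∈ 𝓑 n, 0 ≤ φ b) →
      ∃ ψ : C(ι → G, ℝ) →ₗ[ℝ] ℝ,
        IsBootstrapFeasible r k S β (polyAlgebra (ι := ι) r : Set C(ι → G, ℝ)) ψ ∧
        (∀ R ∈ 𝓡, ∀ a ∈ polyAlgebra (ι := ι) r, ψ (a.comp R) = ψ a) ∧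
        (∀ b ∈ 𝓑inf, 0 ≤ ψ b) ∧ |φ P - ψ P| ≤ ε := by
  classical
  by_contra hcon
  push Not at hcon
  choose φ hφ hinv hcut hfar using hcon
  -- the polynomial derivatives of the local actions
  have hS'ex : ∀ (i : ι) (a : K), ∃ S' ∈ polyAlgebra (ι := ι) r,
      ∀ U, HasDerivAt (fun t => S i (Function.update U i (k a t * U i))) (S' U) 0 := fun i a => by
    obtain ⟨S₀, hS₀, hS₀e⟩ := (mem_polyFunctions_iff r).1 (hS i)
    obtain ⟨S', hS'm, hS'⟩ := exists_deriv_mem_polyAlgebra r (hk a) (hX a) i hS₀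
    exact ⟨S', hS'm, by rw [← hS₀e]; exact hS'⟩
  choose S' hS'm hS'd using hS'ex
  -- archimedean bounds: each polynomial is bounded by finitely many PSD constraints
  have hb : ∀ a : C(ι → G, ℝ), ∃ (C : ℝ) (s : Finset C(ι → G, ℝ)), a ∈ polyAlgebra (ι := ι) r →
      (∀ v ∈ s, v ∈ polyAlgebra (ι := ι) r) ∧ ∀ φ : C(ι → G, ℝ) →ₗ[ℝ] ℝ, φ 1 = 1 →
        (∀ v ∈ s, 0 ≤ φ (v * v)) → |φ a| ≤ C := fun a => by
    by_cases ha : a ∈ polyAlgebra (ι := ι) r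
    · obtain ⟨C, s, h1, h2⟩ := exists_finset_abs_le r ha
      exact ⟨C, s, fun _ => ⟨h1, h2⟩⟩
    · exact ⟨0, ∅, fun h => (ha h).elim⟩
  choose C s hCs using hb
  -- the truncated sequence of putative solutions, as points of the product space
  let good : ℕ → C(ι → G, ℝ) → Prop := fun n a => a ∈ polyAlgebra (ι := ι) r ∧ ∀ v ∈ s a, v ∈ V n
  let Φ : ℕ → (C(ι → G, ℝ) → ℝ) := fun n a => if good n a then φ n a else 0
  have hgood : ∀ a ∈ polyAlgebra (ι := ι) r, ∀ᶠ n in atTop, good n a := fun a ha => by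
    have h : ∀ᶠ n in atTop, ∀ v ∈ s a, v ∈ V n :=
      (Filter.eventually_all_finset (s a)).2 fun v hv => hex v ((hCs a ha).1 v hv)
    exact h.mono fun n hn => ⟨ha, hn⟩
  have hΦeq : ∀ a ∈ polyAlgebra (ι := ι) r, ∀ᶠ n in atTop, Φ n a = φ n a := fun a ha =>
    (hgood a ha).mono fun n hn => if_pos hn
  -- it lives in a compact box (Tychonoff)
  set B : Set (C(ι → G, ℝ) → ℝ) := Set.univ.pi fun a => Set.Icc (-|C a|) |C a| with hB
  have hBc : IsCompact B := isCompact_univ_pi fun a => isCompact_Icc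
  have hΦB : ∀ n, Φ n ∈ B := fun n => Set.mem_univ_pi.2 fun a => by
    by_cases hg : good n a
    · have h := (hCs a hg.1).2 (φ n) (hφ n).1 fun v hv => (hφ n).2.1 v (hg.2 v hv)
      have h' : |Φ n a| ≤ |C a| := by
        simp only [Φ, if_pos hg]
        exact h.trans (le_abs_self _)
      exact ⟨(abs_le.1 h').1, (abs_le.1 h').2⟩
    · simp only [Φ, if_neg hg, Set.mem_Icc, Left.neg_nonpos_iff, abs_nonneg, and_self]
  -- a cluster point
  obtain ⟨x, -, hx⟩ := hBc.exists_clusterPt (f := map Φ atTop)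
    (le_principal_iff.2 (mem_map.2 (Eventually.of_forall hΦB)))
  have key : ∀ {T : Set (C(ι → G, ℝ) → ℝ)}, IsClosed T → (∀ᶠ n in atTop, Φ n ∈ T) → x ∈ T :=
    fun hT hev => mem_of_clusterPt_map hx hT hev
  -- the cluster point solves every untruncated constraint
  have hx1 : x 1 = 1 := by
    refine key (T := {y | y 1 = 1}) (isClosed_eq (continuous_apply _) continuous_const) ?_
    filter_upwards [hΦeq 1 (polyAlgebra (ι := ι) r).one_mem] with n h1
    simp only [h1]
    exact (hφ n).1
  have hxadd : ∀ a ∈ polyAlgebra (ι := ι) r, ∀ b ∈ polyAlgebra (ι := ι) r,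
      x (a + b) = x a + x b := fun a ha b hb => by
    refine key (T := {y | y (a + b) = y a + y b})
      (isClosed_eq (continuous_apply _) ((continuous_apply a).add (continuous_apply b))) ?_
    filter_upwards [hΦeq a ha, hΦeq b hb, hΦeq (a + b) ((polyAlgebra (ι := ι) r).add_mem ha hb)]
      with n h1 h2 h3
    simp only [h1, h2, h3, map_add]
  have hxsmul : ∀ (c : ℝ), ∀ a ∈ polyAlgebra (ι := ι) r, x (c • a) = c * x a := fun c a ha => by
    refine key (T := {y | y (c • a) = c * y a})
      (isClosed_eq (continuous_apply _) (continuous_const.mul (continuous_apply a))) ?_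
    filter_upwards [hΦeq a ha, hΦeq (c • a) ((polyAlgebra (ι := ι) r).smul_mem ha c)] with n h1 h2
    simp only [h1, h2, map_smul, smul_eq_mul]
  have hxpos : ∀ v ∈ polyAlgebra (ι := ι) r, 0 ≤ x (v * v) := fun v hv => by
    refine key (T := {y | 0 ≤ y (v * v)}) (isClosed_le continuous_const (continuous_apply _)) ?_
    filter_upwards [hΦeq (v * v) ((polyAlgebra (ι := ι) r).mul_mem hv hv), hex v hv] with n h1 h2
    simp only [h1]
    exact (hφ n).2.1 v h2
  have hxsd : ∀ (i : ι) (a : K), ∀ f ∈ polyAlgebra (ι := ι) r, ∀ f' ∈ polyAlgebra (ι := ι) r,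
      (∀ U, HasDerivAt (fun t => f (Function.update U i (k a t * U i))) (f' U) 0) →
        x f' = β * x (f * S' i a) := fun i a f hf f' hf' hd => by
    refine key (T := {y | y f' = β * y (f * S' i a)})
      (isClosed_eq (continuous_apply _) (continuous_const.mul (continuous_apply _))) ?_
    filter_upwards [hΦeq f' hf', hΦeq (f * S' i a) ((polyAlgebra (ι := ι) r).mul_mem hf (hS'm i a)),
      hex f hf] with n h1 h2 h3
    simp only [h1, h2]
    obtain ⟨S'', -, hS''d, hrows⟩ := (hφ n).2.2 i a
    have he : S'' = S' i a := ContinuousMap.ext fun U => (hS''d U).unique (hS'd i a U)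
    rw [← he]
    exact hrows f h3 f' hf' hd
  -- the cluster point inherits every imposed invariance
  have hxinv : ∀ R ∈ 𝓡, ∀ a ∈ polyAlgebra (ι := ι) r, x (a.comp R) = x a := fun R hR a ha => by
    refine key (T := {y | y (a.comp R) = y a})
      (isClosed_eq (continuous_apply _) (continuous_apply _)) ?_
    filter_upwards [hΦeq a ha, hΦeq (a.comp R) (h𝓡 R hR a ha), hex a ha] with n h1 h2 h3
    simp only [h1, h2]
    exact hinv n R hR a h3
  -- NEW: the cluster point inherits every eventually imposed cut
  have hxcut : ∀ b ∈ 𝓑inf, 0 ≤ x b := fun b hb => by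
    refine key (T := {y | 0 ≤ y b}) (isClosed_le continuous_const (continuous_apply _)) ?_
    filter_upwards [hΦeq b (h𝓑poly b hb), h𝓑ev b hb] with n h1 h2
    simp only [h1]
    exact hcut n b h2
  have hxfar : ∀ ψ : C(ι → G, ℝ) →ₗ[ℝ] ℝ,
      IsBootstrapFeasible r k S β (polyAlgebra (ι := ι) r : Set C(ι → G, ℝ)) ψ →
      (∀ R ∈ 𝓡, ∀ a ∈ polyAlgebra (ι := ι) r, ψ (a.comp R) = ψ a) → (∀ b ∈ 𝓑inf, 0 ≤ ψ b) →
        ε ≤ |x P - ψ P| :=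
    fun ψ hψ hψinv hψcut => by
    refine key (T := {y | ε ≤ |y P - ψ P|})
      (isClosed_le continuous_const ((continuous_apply P).sub continuous_const).abs) ?_
    filter_upwards [hΦeq P hP] with n h1
    simp only [h1]
    exact (hfar n ψ hψ hψinv hψcut).le
  -- the cluster point IS an invariant untruncated solution satisfying all cuts: contradiction
  let ψ₀ : Subalgebra.toSubmodule (polyAlgebra (ι := ι) r) →ₗ[ℝ] ℝ :=
    { toFun := fun a => x a
      map_add' := fun a b => hxadd a a.2 b b.2
      map_smul' := fun c a => by simpa using hxsmul c a a.2 }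
  obtain ⟨ψ, hψ⟩ := LinearMap.exists_extend ψ₀
  have hψa : ∀ a ∈ polyAlgebra (ι := ι) r, ψ a = x a := fun a ha => by
    have h := LinearMap.congr_fun hψ ⟨a, ha⟩
    simpa [ψ₀] using h
  have hψfeas : IsBootstrapFeasible r k S β (polyAlgebra (ι := ι) r : Set C(ι → G, ℝ)) ψ := by
    refine ⟨by rw [hψa 1 (polyAlgebra (ι := ι) r).one_mem, hx1], fun v hv => ?_, fun i a => ?_⟩
    · rw [hψa _ ((polyAlgebra (ι := ι) r).mul_mem hv hv)]
      exact hxpos v hv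
    · refine ⟨S' i a, hS'm i a, hS'd i a, fun f hf f' hf' hd => ?_⟩
      rw [hψa f' hf', hψa _ ((polyAlgebra (ι := ι) r).mul_mem hf (hS'm i a))]
      exact hxsd i a f hf f' hf' hd
  have hψinv : ∀ R ∈ 𝓡, ∀ a ∈ polyAlgebra (ι := ι) r, ψ (a.comp R) = ψ a := fun R hR a ha => by
    rw [hψa a ha, hψa _ (h𝓡 R hR a ha)]
    exact hxinv R hR a ha
  have hψcut : ∀ b ∈ 𝓑inf, 0 ≤ ψ b := fun b hb => by
    rw [hψa b (h𝓑poly b hb)]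
    exact hxcut b hb
  have h := hxfar ψ hψfeas hψinv hψcut
  rw [hψa P hP, sub_self, abs_zero] at h
  exact absurd h (not_le.2 hε)

end General

end Summit.QuantumFields.GaugeBoot

end
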